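import Mathlib
import HarnessLib
import HarnessLib.Audit

-- provenance: harness21/H21/H21/Statements/PQC/Wave0.lean @ fddaeb8 (interim HEAD d8f2665); M5 mechanical rewrite
/-!
# PQC family — wave 0 statements

Family `pqc` (post-quantum cryptography: factoring, Euclidean lattices, LWE) of the H21
statement library.  This file states the four inventory items that are statable on Mathlib
alone (gap inventory 2026-08-12, `families/pqc.json`):

* **pqc.S03** `FACTORING ∈ FP` (open problem; `summits/factoring/SUMMIT.md` S) — stated as
  `Literature.PQC.FactoringInFP : Prop` via `Turing.TM2ComputableInPolyTime`.
* **pqc.S09** Harvey's deterministic factoring bound `N ^ (1/5 + o(1))`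
  (Harvey 2021, *Math. Comp.* 90, Thm 1.1) — `theorem`, proof `sorry`.
* **pqc.S10** the full-rank lattice `L(B) ⊂ ℝⁿ` generated by a basis and its determinant
  (Micciancio–Goldwasser 2002 Ch. 1; Peikert 2016 §2.1) — real definitions on top of
  `Submodule.span ℤ (Set.range b)`, `IsZLattice`, `ZLattice.covolume`.
* **pqc.S12** Minkowski's convex body theorem (Minkowski 1896; Cassels Ch. III Thm II) — derived
  from Mathlib's `MeasureTheory.exists_ne_zero_mem_lattice_of_measure_mul_two_pow_lt_measure`.

Skipped: none of the `statable_today` items.  The remaining 25 statements of the family need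
notions absent from Mathlib (BQP, LWE distributions, successive minima, GapSVP, …).

## Design choices

* Machine model.  Mathlib's only time-bounded machine model is `Turing.FinTM2` with
  `Turing.TM2ComputableInTime` / `Turing.TM2ComputableInPolyTime`; time is the number of TM2
  statements executed as a function of the *input length*.  Integers are encoded in binary by
  `Computability.encodeNat` (so input length is `⌈log₂ N⌉` up to `O(1)`), and the output
  factorisation `Nat.primeFactorsList N` (sorted, with multiplicity) is encoded over the alphabet
  `Option Bool` by `Literature.Computability.Cryptography.encodeListNat` (binary blocks terminated by the separator `none`).
  The factoring function itself is Mathlib's `Nat.primeFactorsList` (no alias).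
  For **pqc.S09** this carries the usual caveat that Harvey's bound is in bit operations on a
  multitape machine.  The exponent `1/5 + o(1)` is rendered uniformly in the machine:
  `∃ M, ∀ ε > 0, ∃ C, ∀ n, time ≤ C · 2 ^ ((1/5 + ε) n)` — one machine, with the model's
  constant-factor overhead absorbed by `C`.
* Lattices.  A "full-rank lattice with basis `B`" is `Submodule.span ℤ (Set.range b)` for a real
  basis `b : Basis ι ℝ E`; Mathlib already provides the `DiscreteTopology` and `IsZLattice ℝ`
  instances, and the lattice determinant is Mathlib's `ZLattice.covolume` (used directly, no
  alias).  We only add the thin wrapper `latticeOfBasis` so that the inventory id has a home,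
  plus the `|det B|` formula on `ι → ℝ` (a specialisation of `ZLattice.covolume_eq_det`).
-/

open Module MeasureTheory Submodule

namespace Literature.Computability.Cryptography

/-! ### Factoring as a function problem -/

section Factoring

open Turing _root_.Computability

/-- Encoding of a list of natural numbers over the three-letter alphabet `Option Bool`: each entry
is written in binary (`Computability.encodeNat`, letters `some b`) and terminated by the separator
`none`.  Used as the output encoding of the factoring function.  (Glue for **pqc.S03**/**pqc.S09**;
standard, cf. Arora–Barak 2009 §1.2.) [cite: AroraBarak2009, §1.2] -/
def encodeListNat (l : List ℕ) : List (Option Bool) :=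
  l.flatMap fun n => (encodeNat n).map some ++ [none]

/-- Decoding for `encodeListNat`: split at the separators `none` and decode each binary block. [folklore] -/
def decodeListNat (w : List (Option Bool)) : List ℕ :=
  ((w.splitOn none).dropLast).map fun block => decodeNat (block.filterMap id)

/-- Unfolding `encodeListNat` on a nonempty list. [folklore] -/
theorem encodeListNat_cons (n : ℕ) (l : List ℕ) :
    encodeListNat (n :: l) = (encodeNat n).map some ++ none :: encodeListNat l := by
  simp [encodeListNat]

/-- `decodeListNat` is a left inverse of `encodeListNat`. [folklore] -/
@[simp]
theorem decodeListNat_encodeListNat (l : List ℕ) : decodeListNat (encodeListNat l) = l := by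
  induction l with
  | nil => rfl
  | cons n l ih =>
    have h : (encodeListNat (n :: l)).splitOn none =
        (encodeNat n).map some :: (encodeListNat l).splitOn none := by
      rw [encodeListNat_cons]
      refine List.splitOn_append_cons_of_forall_mem_beq_eq_false ?_ _ (by simp) _
      simp only [List.mem_map]
      rintro _ ⟨b, -, rfl⟩
      rfl
    simp only [decodeListNat] at ih ⊢
    rw [h, List.dropLast_cons_of_ne_nil (List.splitOn_ne_nil _ _), List.map_cons, ih]
    simp [List.filterMap_map]

/-- `encodeListNat`/`decodeListNat` bundled as a `Computability.Encoding` of `List ℕ` over the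
finite alphabet `Option Bool` (glue for **pqc.S03**/**pqc.S09**). [folklore] -/
def encodingListNat : Encoding (List ℕ) (Option Bool) where
  encode := encodeListNat
  decode := some ∘ decodeListNat
  decode_encode l := congr_arg some (decodeListNat_encodeListNat l)

/-- **pqc.S03** (`FACTORING ∈ FP`, open; summits/factoring/SUMMIT.md S).  There is a deterministic
Turing machine which, on input the binary representation of `N`, outputs the prime factorisation
of `N` within `(⌈log₂ N⌉) ^ c + c` steps for some constant `c`.  Formally: the integer
factorisation function `Nat.primeFactorsList` (`N ↦` list of prime factors with multiplicity in
non-decreasing order, e.g. `12 ↦ [2, 2, 3]`; junk values `0 ↦ []`, `1 ↦ []`), with binary input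
encoding `Computability.encodeNat` and output encoding `encodeListNat`, is
`Turing.TM2ComputableInPolyTime`.  This is an open problem, hence a `Prop`-valued definition and
not a theorem. [folklore] -/
@[conjecture] def FactoringInFP : Prop :=
  Nonempty (TM2ComputableInPolyTime encodeNat encodeListNat Nat.primeFactorsList)

/-- **pqc.S09** (Harvey 2021, *Math. Comp.* 90, Thm 1.1: deterministic integer factorisation in
`N ^ (1/5 + o(1))` bit operations).  There is a single deterministic Turing machine `M` computing
`Nat.primeFactorsList` (binary input `Computability.encodeNat`, output `encodeListNat`) such that
for every `ε > 0` there is a constant `C` with running time on inputs of length `n` at most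
`C * 2 ^ ((1/5 + ε) * n)` for all `n`.  Model caveat: stated for Mathlib's `Turing.FinTM2` step
count (`Turing.TM2ComputableInTime`) rather than multitape bit operations; the constant-factor
simulation overhead is absorbed by `C`. [cite: Harvey2021, Math. Comp.  90  Thm 1.1: deterministic] -/
def harvey_factoring_one_fifth : Prop :=
  ∃ M : TM2ComputableInTime encodeNat encodeListNat Nat.primeFactorsList, ∀ ε : ℝ, 0 < ε →
      ∃ C : ℝ, ∀ n : ℕ, (M.time n : ℝ) ≤ C * 2 ^ ((1 / 5 + ε) * n)

end Factoring

/-! ### Euclidean lattices -/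

section Lattice

variable {E ι : Type*} [NormedAddCommGroup E] [NormedSpace ℝ E] [Finite ι]

/-- **pqc.S10** (Micciancio–Goldwasser 2002 Ch. 1, Def. 1.1; Peikert 2016 §2.1).  The (full-rank)
lattice `L(B) = {∑ zᵢ bᵢ | z ∈ ℤⁿ}` generated by a basis `B = (bᵢ)` of the real vector space `E`,
as a `ℤ`-submodule of `E`.  This is `Submodule.span ℤ (Set.range b)`; Mathlib equips it with
`DiscreteTopology` and `IsZLattice ℝ` instances (`instIsZLatticeRealSpan`), which apply
transparently since this is an `abbrev` (see the two `example`s below). [cite: MicciancioGoldwasser2002, Ch. 1  Def. 1.1] -/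
abbrev latticeOfBasis (b : Basis ι ℝ E) : Submodule ℤ E :=
  span ℤ (Set.range b)

example (b : Basis ι ℝ E) : DiscreteTopology (latticeOfBasis b) := inferInstance

example (b : Basis ι ℝ E) : IsZLattice ℝ (latticeOfBasis b) := inferInstance

/-- **pqc.S10** (determinant of a lattice; Micciancio–Goldwasser 2002 Ch. 1, Def. 1.6;
Peikert 2016 §2.1).  The determinant `det L` of a full-rank lattice `L` is the volume of a
fundamental domain — Mathlib's `ZLattice.covolume L` (used directly; note `ZLattice.covolume`
accepts any `ℤ`-submodule and returns a junk value when `L` is not a full-rank lattice).  For a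
basis `B` of `ℝⁿ`, `det L(B) = |det B|`, where `B` is viewed as the matrix `Matrix.of b` whose rows
are the basis vectors.  This is the specialisation to an `ℝ`-basis of Mathlib's
`ZLattice.covolume_eq_det` (which is phrased for a `ℤ`-basis of `L`). [cite: MicciancioGoldwasser2002, Ch. 1  Def. 1.6] -/
theorem covolume_latticeOfBasis_eq_abs_det [Fintype ι] [DecidableEq ι]
    (b : Basis ι ℝ (ι → ℝ)) :
    ZLattice.covolume (latticeOfBasis b) = |(Matrix.of b).det| := by
  rw [ZLattice.covolume_eq_measure_fundamentalDomain _ _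
    (ZSpan.isAddFundamentalDomain b volume), ZSpan.volume_real_fundamentalDomain]

variable [MeasurableSpace E]

/-- **pqc.S12** (Minkowski's convex body theorem; Minkowski 1896, Cassels, *Geometry of Numbers*,
Ch. III Thm II).  Let `L` be a full-rank lattice in the `n`-dimensional real vector space `E` and
let `s ⊆ E` be convex and symmetric about the origin with `vol s > 2 ^ n * det L`
(`det L = ZLattice.covolume L μ`).  Then `s` contains a nonzero point of `L`.  This is a
repackaging, in terms of `ZLattice.covolume`, of Mathlib's
`MeasureTheory.exists_ne_zero_mem_lattice_of_measure_mul_two_pow_lt_measure`. [cite: Minkowski1896, Cassels   Geometry of Numbers   Ch. III] -/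
theorem exists_ne_zero_mem_of_two_pow_mul_covolume_lt_measure [BorelSpace E]
    [FiniteDimensional ℝ E] (μ : Measure E) [μ.IsAddHaarMeasure]
    (L : Submodule ℤ E) [DiscreteTopology L] [IsZLattice ℝ L] {s : Set E}
    (h_symm : ∀ x ∈ s, -x ∈ s) (h_conv : Convex ℝ s)
    (h : (2 : ENNReal) ^ finrank ℝ E * ENNReal.ofReal (ZLattice.covolume L μ) < μ s) :
    ∃ x ∈ L, x ≠ 0 ∧ x ∈ s := by
  have fund := ZLattice.isAddFundamentalDomain (Free.chooseBasis ℤ L) μ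
  have hcov := ZLattice.covolume_eq_measure_fundamentalDomain L μ fund
  have hF : μ (ZSpan.fundamentalDomain ((Free.chooseBasis ℤ L).ofZLatticeBasis ℝ)) < ⊤ :=
    (ZSpan.fundamentalDomain_isBounded _).measure_lt_top
  have h' : μ (ZSpan.fundamentalDomain ((Free.chooseBasis ℤ L).ofZLatticeBasis ℝ)) *
      2 ^ finrank ℝ E < μ s := by
    rw [mul_comm]
    convert h using 2
    rw [hcov, Measure.real, ENNReal.ofReal_toReal hF.ne]
  haveI : Countable L.toAddSubgroup := inferInstanceAs (Countable L)
  obtain ⟨⟨x, hxL⟩, hx0, hxs⟩ :=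
    MeasureTheory.exists_ne_zero_mem_lattice_of_measure_mul_two_pow_lt_measure
      (L := L.toAddSubgroup) fund h_symm h_conv h'
  exact ⟨x, hxL, fun h0 => hx0 (by simp [h0]), hxs⟩

end Lattice

end Literature.Computability.Cryptography
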